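import Summits.NavierStokesRegularity.NavierStokesRegularity.Theses.TypeICertificateLadder
import Summits.NavierStokesRegularity.NavierStokesRegularity.Theorems.SqueezeCycleExtremalBiaxialitySubcriticalSmallConstant
import Literature.Analysis.FluidPDE.TypeIAncientMildClassical
import Literature.Analysis.FluidPDE.AncientSimilarityVariables

/-!
# Crux `NoTypeIBlowup` (stmt-NavierStokesRegularity-1217), line `head-flux-channel`, stub S4
# `stub_headInfluxLaw`: the SMALL-`C` RUNG IS ALREADY A THEOREM (candidate evidence for the lead)

drefute gen-2 (refuter-drefute-stmt-NavierStokesRegularity-1217-g2-0), positive side-product — NOT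
landed by the refuter; attach/land `--supports stmt-NavierStokesRegularity-1217` if useful.

The skeleton plans a small-`C` sub-case of the head-influx law by Gaussian-shell estimates. No
estimate is needed below the universal ancient Leray threshold: the tree theorem
`Theorems.exists_typeIAncientMild_eq_zero_of_small` (file
`SqueezeCycleExtremalBiaxialitySubcriticalSmallConstant.lean`; KNSS 2009 §4 bilinear bound + the
self-improving Type-I bound, i.e. the ancient form of Leray 1934 (3.9)) says that for `C ≤ ε` the
class `IsTypeIAncientMild C` is `{0}` on `t < 0`; then `U = lerayOrbit u ≡ 0`, both sides of the
law vanish, and the law holds with `ε' = 1/2`, `S₀ = 0`. So the informative range of S4 is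
`C > ε` (where, by S2–S3, S4 ⇔ Type-I Liouville in the rate class).
-/

noncomputable section

namespace Summit.NavierStokesRegularity.NavierStokesRegularity.Theorems

set_option linter.dupNamespace false

open MeasureTheory Set Filter Topology
open scoped RealInnerProductSpace
open Literature.Analysis.FluidPDE

/-- **S4 below the ancient Leray threshold.** There is a universal `ε > 0` such that the
head-influx law `∫ₐᵇ (−½Ch) ≤ (1 − ε') ∫ₐᵇ (D + E)` (notation of the skeleton
`Cruxes/Target/Lines/head-flux-channel.lean`, S2/S4) holds — with `ε' = 1/2`, `S₀ = 0` — for every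
Type-I ancient mild field with constant `C ≤ ε` and every scalar field `p`: the class is trivial
there (`exists_typeIAncientMild_eq_zero_of_small`), so `lerayOrbit u ≡ 0` and both sides vanish.
[cite: Leray1934, (3.9); KochNadirashviliSereginSverak2009, §4 p. 8] -/
theorem stub_headInfluxLaw_of_small :
    ∃ ε : ℝ, 0 < ε ∧ ∀ (C : ℝ) (u : ℝ → EuclideanSpace ℝ (Fin 3) → EuclideanSpace ℝ (Fin 3))
      (p : ℝ → EuclideanSpace ℝ (Fin 3) → ℝ),
      IsTypeIAncientMild C u → C ≤ ε →
      ∃ ε' : ℝ, 0 < ε' ∧ ∃ S₀ : ℝ, ∀ a b : ℝ, a + S₀ ≤ b →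
        (∫ s in a..b, -(∫ y, (‖lerayOrbit u s y‖ ^ 2 / 2 + lerayOrbitPressure p s y) *
            ⟪y, lerayOrbit u s y⟫ * Real.exp (-‖y‖ ^ 2 / 4)) / 2) ≤
          (1 - ε') * ∫ s in a..b,
            ((∫ y, frobeniusNormSq (fderiv ℝ (lerayOrbit u s) y) * Real.exp (-‖y‖ ^ 2 / 4)) +
              ∫ y, ‖lerayOrbit u s y‖ ^ 2 / 2 * Real.exp (-‖y‖ ^ 2 / 4)) := by
  obtain ⟨ε, hε, hsmall⟩ := exists_typeIAncientMild_eq_zero_of_small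
  refine ⟨ε, hε, fun C u p hA hC => ⟨1 / 2, by norm_num, 0, fun a b _ => ?_⟩⟩
  have hz : ∀ t < 0, ∀ x, u t x = 0 := hsmall C u hA hC
  have hU : ∀ s : ℝ, lerayOrbit u s = fun _ => 0 := fun s => by
    funext y
    rw [lerayOrbit_apply, hz _ (neg_exp_neg_lt_zero s), smul_zero]
  have hUy : ∀ (s : ℝ) (y : EuclideanSpace ℝ (Fin 3)), lerayOrbit u s y = 0 := fun s y => by
    rw [hU s]
  have hfd : ∀ (s : ℝ) (y : EuclideanSpace ℝ (Fin 3)), fderiv ℝ (lerayOrbit u s) y = 0 :=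
    fun s y => by rw [hU s]; simp
  simp only [hUy, hfd, frobeniusNormSq_zero, norm_zero, inner_zero_right, mul_zero, zero_mul,
    integral_zero, neg_zero, zero_div, intervalIntegral.integral_zero]
  norm_num

/-- The same, in the exact shape of the stub (with the classical-pressure hypothesis, unused). -/
theorem stub_headInfluxLaw_of_small' :
    ∃ ε : ℝ, 0 < ε ∧ ∀ (C : ℝ), C ≤ ε →
      ∀ (u : ℝ → EuclideanSpace ℝ (Fin 3) → EuclideanSpace ℝ (Fin 3))
      (p : ℝ → EuclideanSpace ℝ (Fin 3) → ℝ),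
      IsTypeIAncientMild C u → IsClassicalNSSolutionOn (Set.Iio 0) 1 0 u p →
      ∃ ε : ℝ, 0 < ε ∧ ∃ S₀ : ℝ, ∀ a b : ℝ, a + S₀ ≤ b →
        (∫ s in a..b, -(∫ y, (‖lerayOrbit u s y‖ ^ 2 / 2 + lerayOrbitPressure p s y) *
            ⟪y, lerayOrbit u s y⟫ * Real.exp (-‖y‖ ^ 2 / 4)) / 2) ≤
          (1 - ε) * ∫ s in a..b,
            ((∫ y, frobeniusNormSq (fderiv ℝ (lerayOrbit u s) y) * Real.exp (-‖y‖ ^ 2 / 4)) +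
              ∫ y, ‖lerayOrbit u s y‖ ^ 2 / 2 * Real.exp (-‖y‖ ^ 2 / 4)) := by
  obtain ⟨ε, hε, h⟩ := stub_headInfluxLaw_of_small
  exact ⟨ε, hε, fun C hC u p hA _ => h C u p hA hC⟩

end Summit.NavierStokesRegularity.NavierStokesRegularity.Theorems

end
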